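import Summits.QuantumFields.YangMills.Theorems.BalabanUVNodesN21BoxObstacleDecay
import Summits.QuantumFields.YangMills.Theorems.BalabanUVNodesN21BoxObstacleAgmonDecayLetters

/-!
# N21 (NE7c) · the box-obstacle DECAY LETTERS ASSEMBLED: the `ℓ²`-Caccioppoli hypothesis `hCacc` of parts 35∕36
# discharged by the box minimiser's first-order condition (part 33) — pointwise decay of the projected-centre
# correction from the box-minimiser hypotheses alone

R134 seat pub-ymgap-dag-n21-d (g8), node N21 = NE7c (single-run shell-weight bound, NOT PRINTED in [Bałaban 1983–89],
NOT proved), lane K3⁷ `SpineGivenEndpointR13SepCoPH` (stmt-QuantumFields-20544, `--kind proof --supports … --as helper`).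
Part 39 of the comparison series (this seat's own knit of parts 33 + 35 + 36; the mathematics of those parts is the
lens's `Sketch-nearmiss-g29 §C` ∕ `g30 §A`, credited there).

WHAT.  Parts 36's decay letters `agmon_decay_finiteRange` ∕ `agmon_decay_expEntries` take as a DISPLAYED hypothesis
`hCacc : ∀ η, (η = 0 on the core) → γ‖ηe‖₂² ≤ ½ Σ_x Σ_y |A_xy|·|e_x||e_y|·(η_x − η_y)²`.  For the minimiser `e` of the
quadratic form `v ↦ ⟨v, Av⟩` over a box `Π_b [lo_b, hi_b]` (part 33's obstacle problem: the A-projected centre's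
correction) this IS part 33's `weightedEnergy_le_comm` (first-order condition against the shrunk competitor) followed
by part 35's `caccioppoli_l2_of_energy` (`ℓ²`-coercivity `γ`), provided the box contains `0` at every site off the
core (`lo_b ≤ 0 ≤ hi_b` where the weight may be non-zero).  This file performs that substitution once and for all:
* `hCacc_of_boxMin` — the displayed hypothesis from `(he, hmin, hbox)`;
* `agmon_decay_finiteRange_of_boxMin`, `agmon_decay_expEntries_of_boxMin` — the two decay letters with `hCacc`
  discharged;
* `boxMin_pointwise_decay_finiteRange` — composed with part 35's `energy_le_of_competitor` (`γ‖e‖₂² ≤ Γ₁ Σ_{J} M²` from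
  a feasible competitor supported on the core `J`): the POINTWISE letter
  `γ²·q^{2d(x₀)}·e_{x₀}² ≤ q^{2r}·Γ₁²·Σ_{x∈J} M_x²` — geometric decay of the correction away from the core, sized by the
  core data only.  This is the shape the re-centred dilation road (parts 28∕32∕34) reads as its «core-reading number».
* v1.1 (append-only): `boxMin_pointwise_decay_expEntries` — the same in the printed regime of exponentially decaying
  entries: `γ²·e^{2αρ(x₀)}·e_{x₀}² ≤ e^{2αw}·Γ₂·Γ₁·Σ_{x∈J} M_x²`.

HONEST FRAMING.  [textbook] finite-dimensional quadratic-form algebra; 0 def, 0 sorry; nothing of Bałaban's asserted;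
NE7c NOT PRINTED ∕ NOT proved; N21 NOT discharged; counts unmoved (typed 28∕28 · discharged 5∕27); count-neutral; one
finite 𝕋⁴ at fixed ε — nothing about ℝ⁴ ∕ OS ∕ mass gap ∕ Clay.
-/

open Set Matrix

namespace Summit.QuantumFields.YangMills.Theorems.N21BoxObstacleDecayAssembled

open Summit.QuantumFields.YangMills.Theorems.N21BoxObstacleDecay (weightedEnergy_le_comm)
open Summit.QuantumFields.YangMills.Theorems.N21BoxObstacleAgmonDecay (caccioppoli_l2_of_energy energy_le_of_competitor)
open Summit.QuantumFields.YangMills.Theorems.N21BoxObstacleAgmonDecayLetters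
  (agmon_decay_finiteRange agmon_decay_expEntries)

section Assembled

variable {κ : Type*} [Fintype κ]

/-- **THE `ℓ²`-CACCIOPPOLI HYPOTHESIS OF THE DECAY LETTERS, FROM THE BOX MINIMISER.**  If `e` minimises `⟨v, Av⟩`
over the box `Π_b [lo_b, hi_b]`, `A` is symmetric with `ℓ²`-coercivity `γ`, and the box contains `0` at every site
where the «off-core» predicate `P` holds, then for every weight `η` supported in `{P}`:
`γ Σ_x (η_x e_x)² ≤ ½ Σ_x Σ_y |A_xy|·(|e_x||e_y|)·(η_x − η_y)²`.  (= part 33 `weightedEnergy_le_comm` ∘ part 35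
`caccioppoli_l2_of_energy`.) [textbook] -/
theorem hCacc_of_boxMin (A : Matrix κ κ ℝ) (hA : A.IsSymm) {γ : ℝ}
    (hγ : ∀ a : κ → ℝ, γ * ∑ x, a x ^ 2 ≤ a ⬝ᵥ (A *ᵥ a)) (lo hi e : κ → ℝ)
    (he : ∀ b, lo b ≤ e b ∧ e b ≤ hi b)
    (hmin : ∀ v : κ → ℝ, (∀ b, lo b ≤ v b ∧ v b ≤ hi b) → e ⬝ᵥ (A *ᵥ e) ≤ v ⬝ᵥ (A *ᵥ v))
    (P : κ → Prop) (hbox : ∀ b, P b → lo b ≤ 0 ∧ 0 ≤ hi b) (η : κ → ℝ) (hη : ∀ b, η b ≠ 0 → P b) :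
    γ * ∑ x, (η x * e x) ^ 2 ≤ 1 / 2 * ∑ x, ∑ y, |A x y| * (|e x| * |e y|) * (η x - η y) ^ 2 :=
  caccioppoli_l2_of_energy A hγ e η
    (weightedEnergy_le_comm A hA lo hi e he hmin η fun b hb => hbox b (hη b hb))

/-- **FINITE-RANGE DECAY LETTER FOR THE BOX MINIMISER** (part 36 `agmon_decay_finiteRange` with `hCacc` discharged by
`hCacc_of_boxMin`): `A` symmetric, coercive (`γ`), row sums `≤ Γ₁`, range `r` for the depth `d` (`A_xy ≠ 0 ⇒
d x ≤ d y + r`); the box contains `0` off the core `{d = 0}`; `q ≥ 1` with `(q^r − 1)²Γ₁ ≤ γ`.  Then off the core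
`γ·q^{2d(x₀)}·e_{x₀}² ≤ q^{2r}·Γ₁·‖e‖₂²`. [textbook: Agmon] -/
theorem agmon_decay_finiteRange_of_boxMin (A : Matrix κ κ ℝ) (hA : A.IsSymm) {γ Γ₁ q : ℝ} (hγ0 : 0 < γ)
    (hγ : ∀ a : κ → ℝ, γ * ∑ x, a x ^ 2 ≤ a ⬝ᵥ (A *ᵥ a)) (hΓ : ∀ x, ∑ y, |A x y| ≤ Γ₁)
    (d : κ → ℕ) (r : ℕ) (hrange : ∀ x y, A x y ≠ 0 → d x ≤ d y + r)
    (lo hi e : κ → ℝ) (he : ∀ b, lo b ≤ e b ∧ e b ≤ hi b)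
    (hmin : ∀ v : κ → ℝ, (∀ b, lo b ≤ v b ∧ v b ≤ hi b) → e ⬝ᵥ (A *ᵥ e) ≤ v ⬝ᵥ (A *ᵥ v))
    (hbox : ∀ b, d b ≠ 0 → lo b ≤ 0 ∧ 0 ≤ hi b)
    (hq : 1 ≤ q) (hqγ : (q ^ r - 1) ^ 2 * Γ₁ ≤ γ) (x₀ : κ) (hx₀ : d x₀ ≠ 0) :
    γ * (q ^ d x₀) ^ 2 * e x₀ ^ 2 ≤ (q ^ r) ^ 2 * Γ₁ * ∑ x, e x ^ 2 :=
  agmon_decay_finiteRange A hA hγ0 hΓ d r hrange e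
    (fun η hη => hCacc_of_boxMin A hA hγ lo hi e he hmin (fun b => d b ≠ 0) hbox η hη) hq hqγ x₀ hx₀

/-- **EXPONENTIAL-ENTRY DECAY LETTER FOR THE BOX MINIMISER** (part 36 `agmon_decay_expEntries` with `hCacc`
discharged by `hCacc_of_boxMin`): depth `ρ`, `ℓ`-Lipschitz for a symmetric `ℓ`, `≤ w` on the core `Z`; the box
contains `0` off `Z`; weighted row sums `Σ_y|A_xy|(αℓ)²e^{αℓ} ≤ γ` and `Σ_y|A_xy|e^{2αℓ} ≤ Γ₂`.  Then off `Z`: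
`γ·e^{2αρ(x₀)}·e_{x₀}² ≤ e^{2αw}·Γ₂·‖e‖₂²`. [textbook: Agmon ∕ Combes–Thomas] -/
theorem agmon_decay_expEntries_of_boxMin (A : Matrix κ κ ℝ) (hA : A.IsSymm) {γ Γ₂ α w : ℝ} (hγ0 : 0 < γ)
    (hα : 0 ≤ α) (hγ : ∀ a : κ → ℝ, γ * ∑ x, a x ^ 2 ≤ a ⬝ᵥ (A *ᵥ a))
    (Z : κ → Prop) [DecidablePred Z] (ρ : κ → ℝ) (ℓ : κ → κ → ℝ) (hℓs : ∀ x y, ℓ x y = ℓ y x)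
    (hlip : ∀ x y, ρ x ≤ ρ y + ℓ x y) (hρZ : ∀ y, Z y → ρ y ≤ w)
    (lo hi e : κ → ℝ) (he : ∀ b, lo b ≤ e b ∧ e b ≤ hi b)
    (hmin : ∀ v : κ → ℝ, (∀ b, lo b ≤ v b ∧ v b ≤ hi b) → e ⬝ᵥ (A *ᵥ e) ≤ v ⬝ᵥ (A *ᵥ v))
    (hbox : ∀ b, ¬ Z b → lo b ≤ 0 ∧ 0 ≤ hi b)
    (hS : ∀ x, ∑ y, |A x y| * ((α * ℓ x y) ^ 2 * Real.exp (α * ℓ x y)) ≤ γ)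
    (hB : ∀ x, ∑ y, |A x y| * Real.exp (2 * α * ℓ x y) ≤ Γ₂)
    (x₀ : κ) (hx₀ : ¬ Z x₀) :
    γ * Real.exp (α * ρ x₀) ^ 2 * e x₀ ^ 2 ≤ Real.exp (α * w) ^ 2 * Γ₂ * ∑ x, e x ^ 2 :=
  agmon_decay_expEntries A hA hγ0 hα Z ρ ℓ hℓs hlip hρZ e
    (fun η hη => hCacc_of_boxMin A hA hγ lo hi e he hmin (fun b => ¬ Z b) hbox η hη) hS hB x₀ hx₀

/-- ★ **POINTWISE DECAY OF THE BOX MINIMISER, SIZED BY THE CORE DATA ONLY.**  In the finite-range regime, if moreover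
a feasible competitor `v₀` (in the box) is supported on the core set `J` with `|v₀| ≤ M`, then part 35's
`energy_le_of_competitor` (`γ‖e‖₂² ≤ Γ₁ Σ_{J} M²`) closes the letter:
`γ²·q^{2d(x₀)}·e_{x₀}² ≤ q^{2r}·Γ₁²·Σ_{x∈J} M_x²` for every `x₀` off the core `{d = 0}` — the correction of the
A-projected centre decays geometrically into the block and is bounded by the core (violated-letter) data alone.
[textbook: Agmon + energy comparison] -/
theorem boxMin_pointwise_decay_finiteRange (A : Matrix κ κ ℝ) (hA : A.IsSymm) {γ Γ₁ q : ℝ} (hγ0 : 0 < γ)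
    (hγ : ∀ a : κ → ℝ, γ * ∑ x, a x ^ 2 ≤ a ⬝ᵥ (A *ᵥ a)) (hΓ : ∀ x, ∑ y, |A x y| ≤ Γ₁)
    (d : κ → ℕ) (r : ℕ) (hrange : ∀ x y, A x y ≠ 0 → d x ≤ d y + r)
    (lo hi e : κ → ℝ) (he : ∀ b, lo b ≤ e b ∧ e b ≤ hi b)
    (hmin : ∀ v : κ → ℝ, (∀ b, lo b ≤ v b ∧ v b ≤ hi b) → e ⬝ᵥ (A *ᵥ e) ≤ v ⬝ᵥ (A *ᵥ v))
    (hbox : ∀ b, d b ≠ 0 → lo b ≤ 0 ∧ 0 ≤ hi b)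
    (J : Finset κ) (M v₀ : κ → ℝ) (hv₀ : ∀ b, lo b ≤ v₀ b ∧ v₀ b ≤ hi b)
    (hv₀M : ∀ b, |v₀ b| ≤ M b) (hv₀J : ∀ b, b ∉ J → v₀ b = 0)
    (hq : 1 ≤ q) (hqγ : (q ^ r - 1) ^ 2 * Γ₁ ≤ γ) (x₀ : κ) (hx₀ : d x₀ ≠ 0) :
    γ ^ 2 * (q ^ d x₀) ^ 2 * e x₀ ^ 2 ≤ (q ^ r) ^ 2 * Γ₁ ^ 2 * ∑ x ∈ J, M x ^ 2 := by
  have h1 := agmon_decay_finiteRange_of_boxMin A hA hγ0 hγ hΓ d r hrange lo hi e he hmin hbox hq hqγ x₀ hx₀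
  have h2 := energy_le_of_competitor A hA hγ hΓ lo hi e hmin J M v₀ hv₀ hv₀M hv₀J
  have hΓ0 : 0 ≤ Γ₁ := (Finset.sum_nonneg fun y _ => abs_nonneg (A x₀ y)).trans (hΓ x₀)
  have hq0 : 0 ≤ (q ^ r) ^ 2 * Γ₁ := mul_nonneg (sq_nonneg _) hΓ0
  calc γ ^ 2 * (q ^ d x₀) ^ 2 * e x₀ ^ 2 = γ * (γ * (q ^ d x₀) ^ 2 * e x₀ ^ 2) := by ring
    _ ≤ γ * ((q ^ r) ^ 2 * Γ₁ * ∑ x, e x ^ 2) := mul_le_mul_of_nonneg_left h1 hγ0.le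
    _ = (q ^ r) ^ 2 * Γ₁ * (γ * ∑ x, e x ^ 2) := by ring
    _ ≤ (q ^ r) ^ 2 * Γ₁ * (Γ₁ * ∑ x ∈ J, M x ^ 2) := mul_le_mul_of_nonneg_left h2 hq0
    _ = (q ^ r) ^ 2 * Γ₁ ^ 2 * ∑ x ∈ J, M x ^ 2 := by ring

/-- ★ **POINTWISE DECAY OF THE BOX MINIMISER IN THE PRINTED REGIME (exponentially decaying entries), SIZED BY THE
CORE DATA ONLY** (v1.1 rider: `agmon_decay_expEntries_of_boxMin` ∘ part 35 `energy_le_of_competitor`).  With the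
plain row-sum bound `Σ_y|A_xy| ≤ Γ₁` and a feasible competitor `v₀` supported on `J` with `|v₀| ≤ M`:
`γ²·e^{2αρ(x₀)}·e_{x₀}² ≤ e^{2αw}·Γ₂·Γ₁·Σ_{x∈J} M_x²` off the core `Z` — i.e.
`|e_{x₀}| ≤ e^{−α(ρ(x₀)−w)}·(√(Γ₁Γ₂)∕γ)·(Σ_J M²)^{1∕2}`: exponential decay of the A-projected centre's correction into
the block at any rate `α` the two weighted row sums allow (`2α < δ`), with NO `‖e‖₂` left on the right.
[textbook: Agmon ∕ Combes–Thomas + energy comparison] -/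
theorem boxMin_pointwise_decay_expEntries (A : Matrix κ κ ℝ) (hA : A.IsSymm) {γ Γ₁ Γ₂ α w : ℝ} (hγ0 : 0 < γ)
    (hα : 0 ≤ α) (hγ : ∀ a : κ → ℝ, γ * ∑ x, a x ^ 2 ≤ a ⬝ᵥ (A *ᵥ a)) (hΓ : ∀ x, ∑ y, |A x y| ≤ Γ₁)
    (Z : κ → Prop) [DecidablePred Z] (ρ : κ → ℝ) (ℓ : κ → κ → ℝ) (hℓs : ∀ x y, ℓ x y = ℓ y x)
    (hlip : ∀ x y, ρ x ≤ ρ y + ℓ x y) (hρZ : ∀ y, Z y → ρ y ≤ w)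
    (lo hi e : κ → ℝ) (he : ∀ b, lo b ≤ e b ∧ e b ≤ hi b)
    (hmin : ∀ v : κ → ℝ, (∀ b, lo b ≤ v b ∧ v b ≤ hi b) → e ⬝ᵥ (A *ᵥ e) ≤ v ⬝ᵥ (A *ᵥ v))
    (hbox : ∀ b, ¬ Z b → lo b ≤ 0 ∧ 0 ≤ hi b)
    (hS : ∀ x, ∑ y, |A x y| * ((α * ℓ x y) ^ 2 * Real.exp (α * ℓ x y)) ≤ γ)
    (hB : ∀ x, ∑ y, |A x y| * Real.exp (2 * α * ℓ x y) ≤ Γ₂)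
    (J : Finset κ) (M v₀ : κ → ℝ) (hv₀ : ∀ b, lo b ≤ v₀ b ∧ v₀ b ≤ hi b)
    (hv₀M : ∀ b, |v₀ b| ≤ M b) (hv₀J : ∀ b, b ∉ J → v₀ b = 0)
    (x₀ : κ) (hx₀ : ¬ Z x₀) :
    γ ^ 2 * Real.exp (α * ρ x₀) ^ 2 * e x₀ ^ 2 ≤ Real.exp (α * w) ^ 2 * Γ₂ * Γ₁ * ∑ x ∈ J, M x ^ 2 := by
  have h1 := agmon_decay_expEntries_of_boxMin A hA hγ0 hα hγ Z ρ ℓ hℓs hlip hρZ lo hi e he hmin hbox hS hB x₀ hx₀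
  have h2 := energy_le_of_competitor A hA hγ hΓ lo hi e hmin J M v₀ hv₀ hv₀M hv₀J
  have hΓ2 : 0 ≤ Γ₂ :=
    (Finset.sum_nonneg fun y _ => mul_nonneg (abs_nonneg (A x₀ y)) (Real.exp_pos _).le).trans (hB x₀)
  have hc : 0 ≤ Real.exp (α * w) ^ 2 * Γ₂ := mul_nonneg (sq_nonneg _) hΓ2
  calc γ ^ 2 * Real.exp (α * ρ x₀) ^ 2 * e x₀ ^ 2 = γ * (γ * Real.exp (α * ρ x₀) ^ 2 * e x₀ ^ 2) := by ring
    _ ≤ γ * (Real.exp (α * w) ^ 2 * Γ₂ * ∑ x, e x ^ 2) := mul_le_mul_of_nonneg_left h1 hγ0.le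
    _ = Real.exp (α * w) ^ 2 * Γ₂ * (γ * ∑ x, e x ^ 2) := by ring
    _ ≤ Real.exp (α * w) ^ 2 * Γ₂ * (Γ₁ * ∑ x ∈ J, M x ^ 2) := mul_le_mul_of_nonneg_left h2 hc
    _ = Real.exp (α * w) ^ 2 * Γ₂ * Γ₁ * ∑ x ∈ J, M x ^ 2 := by ring

end Assembled

end Summit.QuantumFields.YangMills.Theorems.N21BoxObstacleDecayAssembled
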